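import Mathlib
import Summits.NavierStokesRegularity.NavierStokesRegularity.Theorems.FilamentSkeletonRssDefectColumnGateQuasimodeWitness
import Summits.NavierStokesRegularity.NavierStokesRegularity.Theorems.FilamentSkeletonRssDefectColumnGateMoments
import Literature.Analysis.FluidPDE.GaussianVortexLinearLam

/-!
# Route `FilamentSkeletonRss` · crux `TransverseReduction1AG` (stmt-NavierStokesRegularity-27853) · line `defect_column_gate_1AG` —
# THE FAR-FIELD FIELDS `W_L = ∇Ψ_L × e₃`: regularity, solenoidality, vorticity, and the three vanishing sectional moments

Helper file (`--supports stmt-NavierStokesRegularity-27853 --as helper`; LEAD of 27853, lane ns-filament-21221-p1 g10).  For the stream function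
`Ψ_L(y) = F₀(y₀)E(y₁)` (`…QuasimodeWitness`): `W_L ∈ C³`, `div W_L = 0`, `curl W_L = −(F₂E + F₀p₂E)e₃`, `W_L = F₀E′e₁ − F₁E e₂`, and for every `c` and every
axial station `τ` the sectional mass and both first moments of `⟨curl(cW_L), e₃⟩` vanish (Fubini on `ℝ²` + `∫F₂ = ∫xF₂ = ∫p₂E = ∫v p₂E = 0` of `…Moments`).
Used by `…FarFieldQuasimodes` (assembly of `FarFieldQuasimodes1A`).  HONEST FRAMING: elementary real analysis on explicit MODEL fields; MODEL rung,
negative side; nothing here bears on Navier–Stokes regularity.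
-/

set_option linter.dupNamespace false

noncomputable section

namespace Summit.NavierStokesRegularity.NavierStokesRegularity.Theorems.DefectColumnGate

open scoped BigOperators Topology InnerProductSpace ContDiff
open Set Function Filter MeasureTheory WithLp
open Literature.Analysis.FluidPDE
open Summit.NavierStokesRegularity.NavierStokesRegularity.Theorems.KelvinGate

/-! ## 1. The fields `W_L = ∇Ψ_L × e₃` -/

/-- `Ψ_L ∈ C^∞`. -/
theorem contDiff_farPsi {L : ℝ} (hL : 0 < L) {n : ℕ∞} :
    ContDiff ℝ n (fun y : EuclideanSpace ℝ (Fin 3) => farProfile L 0 (y 0) * gaussE lamW (y 1)) :=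
  contDiff_sep (contDiff_farProfile hL 0) (contDiff_gaussE lamW)

/-- `W_L` unfolded. -/
theorem farW_eq (L : ℝ) :
    farW L = fun y => cross (gradient (fun y : EuclideanSpace ℝ (Fin 3) => farProfile L 0 (y 0) * gaussE lamW (y 1)) y) (EuclideanSpace.single 2 1) :=
  rfl

/-- `W_L ∈ C³`. -/
theorem contDiff_farW {L : ℝ} (hL : 0 < L) : ContDiff ℝ 3 (farW L) := by
  rw [farW_eq]; exact contDiff_streamField (contDiff_farPsi hL)

/-- `div W_L = 0`. -/
theorem isDivFree_farW {L : ℝ} (hL : 0 < L) : VectorCalculus.IsDivFree (farW L) := by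
  rw [farW_eq]; exact isDivFree_streamField (contDiff_farPsi hL)

/-- `Ψ_L` is axially constant. -/
theorem fderiv_farPsi_axis {L : ℝ} (hL : 0 < L) (y : EuclideanSpace ℝ (Fin 3)) :
    fderiv ℝ (fun y : EuclideanSpace ℝ (Fin 3) => farProfile L 0 (y 0) * gaussE lamW (y 1)) y (EuclideanSpace.single 2 1) = 0 :=
  fderiv_sep_axis (differentiable_farProfile hL 0) (fun x => (hasDerivAt_gaussE lamW x).differentiableAt) y

/-- **`curl W_L = −ΔΨ_L·e₃ = −(F₂E + F₀·p₂E)·e₃`.** -/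
theorem curl_farW {L : ℝ} (hL : 0 < L) (y : EuclideanSpace ℝ (Fin 3)) :
    curl (farW L) y = (-(farProfile L 2 (y 0) * gaussE lamW (y 1)
      + farProfile L 0 (y 0) * ((lamW ^ 2 * y 1 ^ 2 - lamW) * gaussE lamW (y 1)))) • EuclideanSpace.single 2 1 := by
  rw [farW_eq, curl_streamField (contDiff_farPsi hL) (fderiv_farPsi_axis hL) y,
    laplacian_sep (contDiff_farProfile hL 0) (contDiff_gaussE lamW) y, deriv_farProfile hL 0, deriv_farProfile hL 1, deriv2_gaussE_eq]

/-- **`W_L = F₀E′·e₁ − F₁E·e₂`** (indices `0, 1`). -/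
theorem farW_apply {L : ℝ} (hL : 0 < L) (y : EuclideanSpace ℝ (Fin 3)) :
    farW L y = (farProfile L 0 (y 0) * (-(lamW * y 1) * gaussE lamW (y 1))) • EuclideanSpace.single 0 1
      - (farProfile L 1 (y 0) * gaussE lamW (y 1)) • EuclideanSpace.single 1 1 := by
  show cross (gradient (fun y : EuclideanSpace ℝ (Fin 3) => farProfile L 0 (y 0) * gaussE lamW (y 1)) y) (EuclideanSpace.single 2 1) = _
  rw [gradient_sep (hasDerivAt_farProfile hL 0 (y 0)) (hasDerivAt_gaussE lamW (y 1))]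
  ext i; fin_cases i <;> simp [cross, cross_apply]

/-- `‖c·eᵢ‖ = |c|`. -/
theorem norm_smul_single_one (i : Fin 3) (c : ℝ) : ‖c • (EuclideanSpace.single i (1:ℝ) : EuclideanSpace ℝ (Fin 3))‖ = |c| := by
  rw [norm_smul, Real.norm_eq_abs]; rw [EuclideanSpace.norm_eq]; simp

/-- `curl (c·W_L) = c·(−ΔΨ_L)·e₃`. -/
theorem curl_smul_farW {L : ℝ} (hL : 0 < L) (c : ℝ) (y : EuclideanSpace ℝ (Fin 3)) :
    curl (fun z => c • farW L z) y = (c * (-(farProfile L 2 (y 0) * gaussE lamW (y 1)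
      + farProfile L 0 (y 0) * ((lamW ^ 2 * y 1 ^ 2 - lamW) * gaussE lamW (y 1))))) • EuclideanSpace.single 2 1 := by
  rw [curl_const_smul (((contDiff_farW hL).differentiable (by norm_num)) y) c, curl_farW hL y, smul_smul]

/-! ## 2. Sectional coordinates and the three vorticity moments -/

/-- First sectional coordinate of `secPt e₃ e₁ e₂ τ ξ`. -/
theorem secPt_std_apply_zero (τ : ℝ) (ξ : EuclideanSpace ℝ (Fin 2)) :
    secPt (EuclideanSpace.single 2 1) (EuclideanSpace.single 0 1) (EuclideanSpace.single 1 1) τ ξ 0 = ξ 0 := by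
  simp [secPt]

/-- Second sectional coordinate of `secPt e₃ e₁ e₂ τ ξ`. -/
theorem secPt_std_apply_one (τ : ℝ) (ξ : EuclideanSpace ℝ (Fin 2)) :
    secPt (EuclideanSpace.single 2 1) (EuclideanSpace.single 0 1) (EuclideanSpace.single 1 1) τ ξ 1 = ξ 1 := by
  simp [secPt]

/-- The axial vorticity of `c·W_L` on the section: `−c(F₂(ξ₀)E(ξ₁) + F₀(ξ₀)p₂(ξ₁)E(ξ₁))`, independent of the station `τ`. -/
theorem inner_curl_smul_farW_secPt {L : ℝ} (hL : 0 < L) (c τ : ℝ) (ξ : EuclideanSpace ℝ (Fin 2)) :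
    ⟪curl (fun z => c • farW L z) (secPt (EuclideanSpace.single 2 1) (EuclideanSpace.single 0 1) (EuclideanSpace.single 1 1) τ ξ),
        EuclideanSpace.single 2 1⟫_ℝ
      = -c * (farProfile L 2 (ξ 0) * gaussE lamW (ξ 1))
        + -c * (farProfile L 0 (ξ 0) * ((lamW ^ 2 * ξ 1 ^ 2 - lamW) * gaussE lamW (ξ 1))) := by
  have h33 : ⟪(EuclideanSpace.single 2 (1:ℝ) : EuclideanSpace ℝ (Fin 3)), EuclideanSpace.single 2 1⟫_ℝ = 1 := by
    simp
  rw [curl_smul_farW hL, secPt_std_apply_zero, secPt_std_apply_one, real_inner_smul_left, h33]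
  ring

/-- Integrability of separable integrands on `ℝ² = EuclideanSpace ℝ (Fin 2)`. -/
theorem integrable_sep_two {f g : ℝ → ℝ} (hf : Integrable f) (hg : Integrable g) :
    Integrable (fun ξ : EuclideanSpace ℝ (Fin 2) => f (ξ 0) * g (ξ 1)) := by
  have h := Integrable.fintype_prod (ι := Fin 2) (𝕜 := ℝ) (f := fun i : Fin 2 => if i = 0 then f else g)
    (μ := fun _ => volume) (fun i => by fin_cases i <;> simp [hf, hg])
  simp only [Fin.prod_univ_two, Fin.isValue, ↓reduceIte, one_ne_zero] at h
  rw [← volume_pi] at h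
  exact (integrable_comp_toLp_fin_two_iff (fun ξ : EuclideanSpace ℝ (Fin 2) => f (ξ 0) * g (ξ 1))).1 (by simpa using h)

/-- The profiles are integrable. -/
theorem integrable_farProfile {L : ℝ} (hL : 0 < L) (k : ℕ) : Integrable (farProfile L k) :=
  (contDiff_farProfile hL k (n := 0)).continuous.integrable_of_hasCompactSupport (hasCompactSupport_farProfile hL k)

/-- `x·F_k(x)` is integrable. -/
theorem integrable_mul_farProfile {L : ℝ} (hL : 0 < L) (k : ℕ) : Integrable (fun x => x * farProfile L k x) :=
  (continuous_id.mul (contDiff_farProfile hL k (n := 0)).continuous).integrable_of_hasCompactSupport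
    ((hasCompactSupport_farProfile hL k).mul_left)

/-- `p₂E` is integrable. -/
theorem integrable_p2_gaussE : Integrable (fun v : ℝ => (lamW ^ 2 * v ^ 2 - lamW) * gaussE lamW v) := by
  have h := ((integrable_pow_mul_gaussE lamW_pos 2).const_mul (lamW ^ 2)).sub ((integrable_gaussE lamW_pos).const_mul lamW)
  refine h.congr (Filter.Eventually.of_forall fun v => ?_)
  simp only [Pi.sub_apply]; ring

/-- `v·p₂E` is integrable. -/
theorem integrable_mul_p2_gaussE : Integrable (fun v : ℝ => v * ((lamW ^ 2 * v ^ 2 - lamW) * gaussE lamW v)) := by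
  have h := ((integrable_pow_mul_gaussE lamW_pos 3).const_mul (lamW ^ 2)).sub ((integrable_pow_mul_gaussE lamW_pos 1).const_mul lamW)
  refine h.congr (Filter.Eventually.of_forall fun v => ?_)
  simp only [Pi.sub_apply]; ring

/-- `v·E` is integrable. -/
theorem integrable_mul_gaussE : Integrable (fun v : ℝ => v * gaussE lamW v) := by
  simpa using integrable_pow_mul_gaussE lamW_pos 1

/-- **The three sectional vorticity moments of `c·W_L` vanish at every station** (`∫F₂ = ∫xF₂ = 0`, `∫p₂E = ∫v p₂E = 0`). -/
theorem moments_smul_farW {L : ℝ} (hL : 0 < L) (c τ : ℝ) :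
    (∫ ξ : EuclideanSpace ℝ (Fin 2),
        ⟪curl (fun z => c • farW L z) (secPt (EuclideanSpace.single 2 1) (EuclideanSpace.single 0 1) (EuclideanSpace.single 1 1) τ ξ),
          EuclideanSpace.single 2 1⟫_ℝ = 0) ∧
    (∫ ξ : EuclideanSpace ℝ (Fin 2),
        ξ 0 * ⟪curl (fun z => c • farW L z) (secPt (EuclideanSpace.single 2 1) (EuclideanSpace.single 0 1) (EuclideanSpace.single 1 1) τ ξ),
          EuclideanSpace.single 2 1⟫_ℝ = 0) ∧
    (∫ ξ : EuclideanSpace ℝ (Fin 2),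
        ξ 1 * ⟪curl (fun z => c • farW L z) (secPt (EuclideanSpace.single 2 1) (EuclideanSpace.single 0 1) (EuclideanSpace.single 1 1) τ ξ),
          EuclideanSpace.single 2 1⟫_ℝ = 0) := by
  have hF2 : ∫ x, farProfile L 2 x = 0 := integral_farProfile_succ hL 1
  have hxF2 : ∫ x, x * farProfile L 2 x = 0 := integral_mul_farProfile_succ_succ hL 0
  have hq : ∫ v, (lamW ^ 2 * v ^ 2 - lamW) * gaussE lamW v = 0 := integral_gaussE_deriv_two lamW_pos
  have hvq : ∫ v, v * ((lamW ^ 2 * v ^ 2 - lamW) * gaussE lamW v) = 0 := integral_mul_gaussE_deriv_two lamW_pos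
  -- the six separable integrals
  have m1 : ∫ ξ : EuclideanSpace ℝ (Fin 2), farProfile L 2 (ξ 0) * gaussE lamW (ξ 1) = 0 := by
    rw [integral_mul_coord_two (farProfile L 2) (gaussE lamW), hF2, zero_mul]
  have m2 : ∫ ξ : EuclideanSpace ℝ (Fin 2), farProfile L 0 (ξ 0) * ((lamW ^ 2 * ξ 1 ^ 2 - lamW) * gaussE lamW (ξ 1)) = 0 := by
    have h := integral_mul_coord_two (farProfile L 0) (fun v => (lamW ^ 2 * v ^ 2 - lamW) * gaussE lamW v)
    simp only [hq, mul_zero] at h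
    exact h
  have m3 : ∫ ξ : EuclideanSpace ℝ (Fin 2), ξ 0 * farProfile L 2 (ξ 0) * gaussE lamW (ξ 1) = 0 := by
    have h := integral_mul_coord_two (fun x => x * farProfile L 2 x) (gaussE lamW)
    simp only [hxF2, zero_mul] at h
    exact h
  have m4 : ∫ ξ : EuclideanSpace ℝ (Fin 2), ξ 0 * farProfile L 0 (ξ 0) * ((lamW ^ 2 * ξ 1 ^ 2 - lamW) * gaussE lamW (ξ 1)) = 0 := by
    have h := integral_mul_coord_two (fun x => x * farProfile L 0 x) (fun v => (lamW ^ 2 * v ^ 2 - lamW) * gaussE lamW v)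
    simp only [hq, mul_zero] at h
    exact h
  have m5 : ∫ ξ : EuclideanSpace ℝ (Fin 2), farProfile L 2 (ξ 0) * (ξ 1 * gaussE lamW (ξ 1)) = 0 := by
    have h := integral_mul_coord_two (farProfile L 2) (fun v => v * gaussE lamW v)
    simp only [hF2, zero_mul] at h
    exact h
  have m6 : ∫ ξ : EuclideanSpace ℝ (Fin 2), farProfile L 0 (ξ 0) * (ξ 1 * ((lamW ^ 2 * ξ 1 ^ 2 - lamW) * gaussE lamW (ξ 1))) = 0 := by
    have h := integral_mul_coord_two (farProfile L 0) (fun v => v * ((lamW ^ 2 * v ^ 2 - lamW) * gaussE lamW v))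
    simp only [hvq, mul_zero] at h
    exact h
  -- integrability of the six integrands
  have i1 : Integrable (fun ξ : EuclideanSpace ℝ (Fin 2) => -c * (farProfile L 2 (ξ 0) * gaussE lamW (ξ 1))) :=
    (integrable_sep_two (integrable_farProfile hL 2) (integrable_gaussE lamW_pos)).const_mul (-c)
  have i2 : Integrable (fun ξ : EuclideanSpace ℝ (Fin 2) => -c * (farProfile L 0 (ξ 0) * ((lamW ^ 2 * ξ 1 ^ 2 - lamW) * gaussE lamW (ξ 1)))) :=
    (integrable_sep_two (integrable_farProfile hL 0) integrable_p2_gaussE).const_mul (-c)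
  have i3 : Integrable (fun ξ : EuclideanSpace ℝ (Fin 2) => -c * (ξ 0 * farProfile L 2 (ξ 0) * gaussE lamW (ξ 1))) :=
    (integrable_sep_two (integrable_mul_farProfile hL 2) (integrable_gaussE lamW_pos)).const_mul (-c)
  have i4 : Integrable (fun ξ : EuclideanSpace ℝ (Fin 2) => -c * (ξ 0 * farProfile L 0 (ξ 0) * ((lamW ^ 2 * ξ 1 ^ 2 - lamW) * gaussE lamW (ξ 1)))) :=
    (integrable_sep_two (integrable_mul_farProfile hL 0) integrable_p2_gaussE).const_mul (-c)
  have i5 : Integrable (fun ξ : EuclideanSpace ℝ (Fin 2) => -c * (farProfile L 2 (ξ 0) * (ξ 1 * gaussE lamW (ξ 1)))) :=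
    (integrable_sep_two (integrable_farProfile hL 2) integrable_mul_gaussE).const_mul (-c)
  have i6 : Integrable (fun ξ : EuclideanSpace ℝ (Fin 2) => -c * (farProfile L 0 (ξ 0) * (ξ 1 * ((lamW ^ 2 * ξ 1 ^ 2 - lamW) * gaussE lamW (ξ 1))))) :=
    (integrable_sep_two (integrable_farProfile hL 0) integrable_mul_p2_gaussE).const_mul (-c)
  simp_rw [inner_curl_smul_farW_secPt hL]
  refine ⟨?_, ?_, ?_⟩
  · rw [integral_add i1 i2, integral_const_mul, integral_const_mul, m1, m2]; ring
  · have e : ∀ ξ : EuclideanSpace ℝ (Fin 2),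
        ξ 0 * (-c * (farProfile L 2 (ξ 0) * gaussE lamW (ξ 1)) + -c * (farProfile L 0 (ξ 0) * ((lamW ^ 2 * ξ 1 ^ 2 - lamW) * gaussE lamW (ξ 1))))
          = -c * (ξ 0 * farProfile L 2 (ξ 0) * gaussE lamW (ξ 1))
            + -c * (ξ 0 * farProfile L 0 (ξ 0) * ((lamW ^ 2 * ξ 1 ^ 2 - lamW) * gaussE lamW (ξ 1))) := fun ξ => by ring
    simp_rw [e]
    rw [integral_add i3 i4, integral_const_mul, integral_const_mul, m3, m4]; ring
  · have e : ∀ ξ : EuclideanSpace ℝ (Fin 2),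
        ξ 1 * (-c * (farProfile L 2 (ξ 0) * gaussE lamW (ξ 1)) + -c * (farProfile L 0 (ξ 0) * ((lamW ^ 2 * ξ 1 ^ 2 - lamW) * gaussE lamW (ξ 1))))
          = -c * (farProfile L 2 (ξ 0) * (ξ 1 * gaussE lamW (ξ 1)))
            + -c * (farProfile L 0 (ξ 0) * (ξ 1 * ((lamW ^ 2 * ξ 1 ^ 2 - lamW) * gaussE lamW (ξ 1)))) := fun ξ => by ring
    simp_rw [e]
    rw [integral_add i5 i6, integral_const_mul, integral_const_mul, m5, m6]; ring

end Summit.NavierStokesRegularity.NavierStokesRegularity.Theorems.DefectColumnGate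

end
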